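/-
Copyright (c) 2026 the pub-hodgecm-mathlib formalisation cell (harness21).  Prover seat hodgecm-mathlib-LH5-p04 (g3), on loan to line LH3 (closer stub `stub_N9`, N9 «Transf»
direct road), letter L1 clause (I₃) brick (I₃)₀ «THE ORDER-0 UNIVERSAL JUMP OF `orbFamGExt`» (LH3-plan (g3) DEALER BOARD «LETTER L1 AFTER (I₂)» 2026-09-02T09:58:42Z, deal
10:00:43Z, words 10:06:08Z (1) ∕ 10:07:25Z «KEEP (I₃)₀, TWISTED form»); 2026-09-02.
-/
import Literature.NumberTheory.Rogawski1990.ArchOrbFamGExtJumpSideGStatement          -- ★ p850798 (LH3-p02 (g3)): organ-J `G′`-SIDE — the ONE-test-function assembly this file runs for EVERY `a′`; brings every brick below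
import Literature.NumberTheory.Rogawski1990.ArchHCOrbitalFamilyGExt                   -- ★ (G′-EXT) (LH3-p02 (g2)): `orbFamGExt`, `archHcWeyl_orbFamGExt`, `orbFamGExt_of_not_admissible`
import Literature.NumberTheory.Rogawski1990.ArchTransfFamilyWallGeometry               -- ★ (LH7-p02 (g2)): `hcSwapAt` algebra (`hcSwapAt_add_smul`, `hcSwapAt_single_self`, `hcSwapAt_apply_pair`, …)
import Literature.NumberTheory.Rogawski1990.ArchTransfFamilyJumpKit                    -- ★ (LH7-p02 (g2) ∕ LH3-p04 (g3)): `slotSign_of_mem_splitChartPlaces`, `hasOneSidedJump_comp_neg`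
import HarnessLib

/-!
# (I₃)₀ — the ORDER-0 UNIVERSAL JUMP of the twisted extended genuine family `e^{ρ}_{S′} · orbFamGExt ν′ a′ S′` at every noncompact imaginary wall, for EVERY test function
# (Shelstad 1979 Prop. 4.5, Thm. 4.7; Bouaziz 1994 §3.2 (I₃) at order 0; Rogawski 1990 §8.2)

Topic `NumberTheory/Rogawski1990`; namespace `Literature.NumberTheory.Rogawski1990`.  THEOREMS ONLY (no definition, no instance, no notation, no axiom, no named fact, no `sorry`);
kernel lane `--kind proof --supports stmt-HodgeConjecture-24833`.  Cell `pub/hodgecm-mathlib` (D-0151), crux H413 = `stmt-HodgeConjecture-24833`, F0∕P3c line LH3 (closer stub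
`stub_N9`, DIRECT ROAD `F0_P3c_StubN9Direct`), letter L1 `HcOrbitalFamiliesStatement`, clause (I₃) `ArchHcJump` (★ `ArchHCSpaceG` :203), brick **(I₃)₀** = its base case `n = 0`
(empty word): the conclusion shape of ★ `ArchHcJump.order_zero` for `F := orbFamGExt L α ν′ a′`, with the jump constant FIXED as a closed term (the anchor the all-orders road
(B-desc)∕(B-norm)∕(B-trans)∕(B-asm) of SPEC-I3 (F0P3a-p08 (g23)) must reproduce at `n = 0`, LH3-plan (g3) 10:06:08Z).  Author LH5-p04 (g3).

THE MATHEMATICS.  ★ p850798 `orbFamGExt_jumpGSideStatement` assembles, at ONE semiregular point of each covered wall `(S, w, 0, 2)` and for ONE non-negative test function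
`a′` with `a′(γ_s) = 1`, the jump `(i·C₁∕C₂)·(e^{ρ}_{S∪w} · orbFamGExt ν′ a′ (S∪w))(cay s)` of the twisted family along the wall normal, `C₁, C₂` the SHARED rank-one constants
of `(U(J), μ₀, μ₀′)`.  Every descent brick it calls consumes only `Continuous a′` and `HasCompactSupport a′` (★ p850667, p850695, p850417, p850689, p850673, p850544, p850677,
p850743, p850728, ★ `hasOneSidedJump_two_sin_mul_integral_block_of_sharedK0`); the special test function serves only the NON-VANISHING of the Cayley value, and the jump
conjunct of ★ `hasOneSidedJump_orbFamGExt_side_of_bricks` is division-free (its bookkeeping `(i C₁∕C₂)·Λ = i·K·J_b` holds for `J_b = C₁·cone`, `Λ = K·C₂·cone` whatever `cone`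
is).  So (§1) the side head WITHOUT `Λ ≠ 0`, (§2) the same assembly for an ARBITRARY `a′ ∈ C_c^∞(G′_∞)` at the wall `(w, 0, 2)`: jump constant `i·C₁∕C₂`, reading the Cayley
value under the letter's clause (I₂) on the split chart `insert w S` (binder `hsm`, ★ p850798's `hsmAll` token; hypothesis-free the day (A5) lands).  (§3) THE OTHER NONCOMPACT PAIRS
of the slot pattern `slotSign L α` (`slotSign w 0 = slotSign w 1 ≠ slotSign w 2` at an indefinite place, ★ `slotSign_of_mem_splitChartPlaces`): `(2,0)` and `(2,1)` by the
reflection `ν ↦ −ν` (jump `−J`; `hcNrm w j i = −hcNrm w i j`, `hcCayPt w j i = hcCayPt w i j`), `(1,2)` by the REALISED compact Weyl reflection `σ = (0 1)` at `w`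
(★ `archHcWeyl_orbFamGExt`): the twisted normaliser is `σ`-ODD, `e^{ρ}R′(σc) = −e^{ρ}R′(c)` (`e^{i(θ₀−θ₂)}(1 − e^{i(θ₁−θ₀)}) = −e^{i(θ₁−θ₂)}(1 − e^{i(θ₀−θ₁)})`), whence the
twisted members satisfy `(e^{ρ}F)(c) = −(e^{ρ}F)(σc)` off the walls, `σ(p + ν·n₁₂) = σp + ν·n₀₂`, `hcCayPt w 1 2 p = hcCayPt w 0 2 (σp)`, and `σp` is semiregular on `(0,2)`
when `p` is on `(1,2)`.  (§4) THE HEAD: for every `S′, w ∉ S′, i ≠ j` with `slotSign w i ≠ slotSign w j` and every semiregular `p`, the `n = 0` instance of `ArchHcJump` with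
**`jc′ S′ w i j := ε i j · (i·C₁∕C₂)`, `ε 0 2 = ε 2 1 = 1`, `ε 2 0 = ε 1 2 = −1`** (non-admissible `S′`: both sides vanish, ★ `orbFamGExt_of_not_admissible`; the guard
excludes `(0,1)`, `(1,0)`; an indefinite `w` is a split-chart place, ★ `mem_splitChartPlaces_of_frame`).
HONEST LABEL: HC_CM is proved only modulo the 7 printed citations (2 remaining: hLiu418 = `stmt-HodgeConjecture-24832`, h413 = `stmt-HodgeConjecture-24833`) until rung 0 closes;
count-neutral letter-L1 pay-down (no organ is paid here; the order-0 anchor of the (I₃) constant).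

## References
* [Shelstad1979] D. Shelstad, *Characters and inner forms of a quasi-split group over ℝ*, Compositio Math. 39 (1979), §4 Lemma 4.3 p. 25, Prop. 4.5 p. 26, Thm. 4.7 (IIIb) p. 31.
* [Rogawski1990] J. D. Rogawski, *Automorphic Representations of Unitary Groups in Three Variables*, Ann. of Math. Stud. 123 (1990), §4.12 Lemma 4.12.1 p. 66, §8.2 pp. 118–124.
* [Bouaziz1994IntegralesOrbitales] A. Bouaziz, *Intégrales orbitales sur les groupes de Lie réductifs*, Ann. Sci. ÉNS 27 (1994), §3.2 (I₃) p. 580, Rem. 2 p. 594.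
* [Varadarajan1977] V. S. Varadarajan, *Harmonic Analysis on Real Reductive Groups*, LNM 576 (1977), Part I §1.12.
-/

set_option autoImplicit false

noncomputable section

open MeasureTheory MeasureTheory.Measure NumberField NumberField.InfinitePlace Matrix Complex Set Filter Topology
open scoped MatrixGroups Matrix Real Classical ENNReal NNReal ContDiff
open Literature.NumberTheory.Automorphic Literature.NumberTheory.Automorphic.UnitaryGroup Literature.NumberTheory.Automorphic.ArchCartan
open Literature.NumberTheory.Automorphic.Shelstad1979.StableOrbitalIntegrals
open Literature.NumberTheory.GaloisRepresentations Literature.MeasureTheory.Group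

namespace Literature.NumberTheory.Rogawski1990

/-! ## §1 The (JG′) side head WITHOUT the non-vanishing: jump only, division-free -/

section SideJump

variable (L : Type) [Field L] [NumberField L] [IsCMField L] (α : Fin 3 → L)
  [MeasurableSpace ↥(arch (↥(maximalRealSubfield L)) L (IsCMField.complexConj L) 3 (Matrix.diagonal α))] [BorelSpace ↥(arch (↥(maximalRealSubfield L)) L (IsCMField.complexConj L) 3 (Matrix.diagonal α))]
  (ν' : Measure ↥(arch (↥(maximalRealSubfield L)) L (IsCMField.complexConj L) 3 (Matrix.diagonal α))) [IsFiniteMeasureOnCompacts ν'] [ν'.IsMulRightInvariant]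
  (a' : ↥(arch (↥(maximalRealSubfield L)) L (IsCMField.complexConj L) 3 (Matrix.diagonal α)) → ℂ)
  {S : Finset {w : InfinitePlace L // IsComplex w}} (hS : ∀ v, v ∈ S → v ∈ splitChartPlaces L α)
  {w : {w : InfinitePlace L // IsComplex w}} (hw : w ∉ S) (hwsp : w ∈ splitChartPlaces L α)
  {p : {w : InfinitePlace L // IsComplex w} → Fin 3 → ℝ} (hp : HcSemireg S w 0 2 p)
  {K : ℂ} {Φ : ℝ → ℂ} (hdesc : ∀ᶠ ν in 𝓝[≠] (0 : ℝ), chartOrbG L α ν' S a' (p + ν • hcNrm w 0 2) = K * Φ ν)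
  {Jb : ℂ} (hjump : HasOneSidedJump (fun ν : ℝ => (2 * Real.sin ν : ℂ) * Φ ν) Jb)

include hS hw hwsp hp hdesc hjump in
/-- **(JG′) JUMP CONJUNCT, DIVISION-FREE** (★ `hasOneSidedJump_orbFamGExt_side_of_bricks`' first conjunct without `Λ ≠ 0`): from (DESC) `hdesc`, (K0) `hjump`, (CAY-LIM) `hlim` and
(BOOK-G′) `cG · Λ = i·K·J_b`, the twisted extended member along the wall normal jumps by `cG · (e^{ρ}_{S∪w}(cay) · orbFamGExt ν′ a′ (S∪w)(cay))` — whether or not that value vanishes.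
[cite: Shelstad1979, Prop. 4.5 (p. 26)] [cite: Rogawski1990, §8.2 pp. 119–124] [cite: Bouaziz1994IntegralesOrbitales, §3.2 (I₃) p. 580] -/
theorem hasOneSidedJump_orbFamGExt_jump_of_bricks {Λ : ℂ}
    (hlim : Tendsto (fun c => ((|Real.exp (c w 0) - Real.exp (-c w 0)| : ℝ) : ℂ) * chartOrbG L α ν' (insert w S) a' c) (𝓝[RegG (insert w S)] (hcCayPt w 0 2 p)) (𝓝 Λ))
    {cG : ℂ} (hcG : cG * Λ = I * (K * Jb)) :
    HasOneSidedJump (fun ν : ℝ => archERhoG S (p + ν • hcNrm w 0 2) * orbFamGExt L α ν' a' S (p + ν • hcNrm w 0 2))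
      (cG * (archERhoG (insert w S) (hcCayPt w 0 2 p) * orbFamGExt L α ν' a' (insert w S) (hcCayPt w 0 2 p))) := by
  -- the compact-chart wall factor along the normal ((c-wall) ★ p850367), with `r` explicit
  obtain ⟨R, r, hR, hwall, hr⟩ := exists_wallFactor_archERhoG_mul_archRG S hw hp.1
  -- the split-chart wall factor at the Cayley point, cofactor abstracted (★ `exists_splitCofactor_insert`)
  obtain ⟨C, hC, hfac, hjunc, -⟩ := exists_splitCofactor_insert S hp
  have hrI : r = I * (archERhoG (insert w S) (hcCayPt w 0 2 p) * C (hcCayPt w 0 2 p)) := hr.trans hjunc.symm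
  -- the shell: jump `r · K · J_b` (★ `hasOneSidedJump_archERhoG_mul_orbFamGExt_of_bricks`)
  have hJ := hasOneSidedJump_archERhoG_mul_orbFamGExt_of_bricks L α ν' a' hS hw hp hdesc hjump hwall hR
  -- the Cayley value `C(cay) · Λ` (★ `orbFamGExt_insert_hcCayPt_eq_mul_of_tendsto`)
  have hval : orbFamGExt L α ν' a' (insert w S) (hcCayPt w 0 2 p) = C (hcCayPt w 0 2 p) * Λ :=
    orbFamGExt_insert_hcCayPt_eq_mul_of_tendsto L α ν' a' hS hwsp hp hC hfac hlim
  have heq : r * K * Jb = cG * (archERhoG (insert w S) (hcCayPt w 0 2 p) * orbFamGExt L α ν' a' (insert w S) (hcCayPt w 0 2 p)) := by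
    rw [hval, hrI]
    linear_combination (-(archERhoG (insert w S) (hcCayPt w 0 2 p) * C (hcCayPt w 0 2 p))) * hcG
  rw [← heq]
  exact hJ

include hS hw hwsp hp hdesc hjump in
/-- **(JG′) JUMP CONJUNCT READ FROM THE `x`-RAY, WITH THE SHARED LITERAL `i·C₁∕C₂`** (★ `hasOneSidedJump_orbFamGExt_side_of_bricks_of_cayRay_std`'s first conjunct without
`cone ≠ 0`, `K ≠ 0`): under (I₂) on the split chart (`hsm`) and the ray limit `hray`, with `J_b = C₁·cone`, `Λ = K·(C₂·cone)`, `C₂ ≠ 0`, the jump constant is `(I * C₁ / C₂ : ℂ)`.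
[cite: Shelstad1979, Prop. 4.5 (p. 26); Thm. 4.7 (IIIb) (p. 31)] [cite: Rogawski1990, §8.2 Prop. 8.2.1 (c) p. 119; p. 122] [cite: Varadarajan1977, I §1.12] -/
theorem hasOneSidedJump_orbFamGExt_jump_of_cayRay_std {C₁ C₂ : ℝ} {cone Λ : ℂ} (hJb : Jb = (C₁ : ℂ) * cone) (hΛ : Λ = K * ((C₂ : ℂ) * cone)) (hC₂ : C₂ ≠ 0)
    (hsm : ContDiffOn ℝ ∞ (orbFamGExt L α ν' a' (insert w S)) (InRegG (slotSign L α) (insert w S)))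
    (hray : Tendsto (fun x : ℝ => ((|Real.exp x - Real.exp (-x)| : ℝ) : ℂ) *
        chartOrbG L α ν' (insert w S) a' (hcCayPt w 0 2 p + x • (Pi.single w (Pi.single 0 1 : Fin 3 → ℝ) : {w : InfinitePlace L // IsComplex w} → Fin 3 → ℝ)))
      (𝓝[>] (0 : ℝ)) (𝓝 Λ)) :
    HasOneSidedJump (fun ν : ℝ => archERhoG S (p + ν • hcNrm w 0 2) * orbFamGExt L α ν' a' S (p + ν • hcNrm w 0 2))
      ((I * C₁ / C₂ : ℂ) * (archERhoG (insert w S) (hcCayPt w 0 2 p) * orbFamGExt L α ν' a' (insert w S) (hcCayPt w 0 2 p))) := by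
  have hC₂' : (C₂ : ℂ) ≠ 0 := Complex.ofReal_ne_zero.2 hC₂
  have hcG : (I * C₁ / C₂ : ℂ) * Λ = I * (K * Jb) := by
    rw [hΛ, hJb]
    field_simp
  exact hasOneSidedJump_orbFamGExt_jump_of_bricks L α ν' a' hS hw hwsp hp hdesc hjump
    (tendsto_absSub_mul_chartOrbG_nhdsWithin_regG_of_tendsto_cayRay L α ν' a' hS hwsp hp hsm hray) hcG

end SideJump

/-! ## §2 The order-0 jump at the wall `(w, 0, 2)` for EVERY test function (★ p850798's assembly, general `a′`) -/

/-- **(I₃)₀ AT THE WALL `(w, 0, 2)`, EVERY `a′`.**  Under the frame hypotheses (`diag α` hermitian anisotropic), the SHARED rank-one datum `(U(J), μ₀, μ₀′, C₁, C₂)` with its (K0±)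
text `hK0`, (A0) text `hA0` and link `hlink` (★ p850798's binder block VERBATIM): for every admissible chart `S`, split-chart place `w ∉ S`, semiregular point `s` of the wall
`(w, 0, 2)`, every `a′ ∈ C_c^∞(G′_∞)` whose extended family satisfies (I₂) on the split chart `insert w S`, the twisted extended family along the wall normal has both one-sided
limits at `ν = 0` and jumps by `(i·C₁∕C₂) · (e^{ρ}_{S∪w}(cay s) · orbFamGExt ν′ a′ (S∪w)(cay s))`.  Proof = ★ p850798's assembly with the test function GENERAL ((N1′) and the
non-vanishing dropped; §1's division-free head closes it). [cite: Shelstad1979, Prop. 4.5 (p. 26); Thm. 4.7 (IIIb) (p. 31)] [cite: Rogawski1990, §8.2 Prop. 8.2.1 (c) p. 119; §4.12 Lemma 4.12.1 p. 66]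
[cite: Bouaziz1994IntegralesOrbitales, §3.2 (I₃) p. 580; Rem. 2 p. 594] [cite: Varadarajan1989, §6.4 Thm 23] -/
theorem hasOneSidedJump_archERhoG_mul_orbFamGExt_wall02 :
  ∀ (L : Type) [Field L] [NumberField L] [IsCMField L] (α : Fin 3 → L)
    [MeasurableSpace (↥(arch (↥(maximalRealSubfield L)) L (IsCMField.complexConj L) 3 (Matrix.diagonal α)))] [BorelSpace (↥(arch (↥(maximalRealSubfield L)) L (IsCMField.complexConj L) 3 (Matrix.diagonal α)))]
    (ν' : Measure (↥(arch (↥(maximalRealSubfield L)) L (IsCMField.complexConj L) 3 (Matrix.diagonal α)))) [ν'.IsHaarMeasure] [ν'.IsMulRightInvariant],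
    ((Matrix.diagonal α).map (cmConjRingHom L)).transpose = Matrix.diagonal α →
    (∀ x : Fin 3 → L, Literature.AlgebraicGeometry.ShimuraVarieties.hermForm (cmConjRingHom L) (Matrix.diagonal α) x x = 0 → x = 0) →
    ∀ {J : Matrix (Fin 2) (Fin 2) ℂ} (hJ : J = (StdForm.antidiagonal 2).over ℂ)
      [MeasurableSpace ↥(unitaryGroupOfForm (starRingEnd ℂ) J)] [BorelSpace ↥(unitaryGroupOfForm (starRingEnd ℂ) J)]
      [LocallyCompactSpace ↥(unitaryGroupOfForm (starRingEnd ℂ) J)] [SecondCountableTopology ↥(unitaryGroupOfForm (starRingEnd ℂ) J)]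
      [MeasurableSpace (↥(unitaryGroupOfForm (starRingEnd ℂ) J) ⧸ torusU (starRingEnd ℂ) J)] [BorelSpace (↥(unitaryGroupOfForm (starRingEnd ℂ) J) ⧸ torusU (starRingEnd ℂ) J)]
      (μ₀ : Measure ↥(unitaryGroupOfForm (starRingEnd ℂ) J)) [μ₀.IsHaarMeasure] [μ₀.IsMulRightInvariant]
      (μ₀' : Measure (↥(unitaryGroupOfForm (starRingEnd ℂ) J) ⧸ torusU (starRingEnd ℂ) J)) [SMulInvariantMeasure ↥(unitaryGroupOfForm (starRingEnd ℂ) J) (↥(unitaryGroupOfForm (starRingEnd ℂ) J) ⧸ torusU (starRingEnd ℂ) J) μ₀'] [IsFiniteMeasureOnCompacts μ₀']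
      (C₁ C₂ : ℝ), 0 < C₁ → 0 < C₂ →
      (∀ (f : Matrix (Fin 2) (Fin 2) ℂ → ℂ), Continuous f → HasCompactSupport f → ∀ z : Circle,
        HasOneSidedJump (fun ψ : ℝ => (2 * Real.sin ψ : ℂ) *
            ∫ h : ↥(unitaryGroupOfForm (starRingEnd ℂ) J),
              f (((h * ⟨Matrix.GeneralLinearGroup.mkOfDetNeZero !![(1 : ℂ), 1; 1, -1] det_cayleyTwo_ne_zero *
                    circleDiagonal 2 ![z * Circle.exp ψ, z * Circle.exp (-ψ)] *
                    (Matrix.GeneralLinearGroup.mkOfDetNeZero !![(1 : ℂ), 1; 1, -1] det_cayleyTwo_ne_zero)⁻¹,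
                  cayley_conj_circleDiagonal_mem_of_eq_over hJ _⟩ * h⁻¹ :
                ↥(unitaryGroupOfForm (starRingEnd ℂ) J)) : GL (Fin 2) ℂ) : Matrix (Fin 2) (Fin 2) ℂ) ∂μ₀)
          ((C₁ : ℂ) * ((∫ p in Ioi (0 : ℝ) ×ˢ Ioc (0 : ℝ) (2 * π),
              f ((!![(1 : ℂ), 1; 1, -1] : Matrix (Fin 2) (Fin 2) ℂ) *
                ((z : ℂ) • (1 : Matrix (Fin 2) (Fin 2) ℂ) + p.1 • Matrix.diagonal ![(z : ℂ) * I, -((z : ℂ) * I)] +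
                  p.1 • !![(0 : ℂ), -((z : ℂ) * I) * cexp (-((p.2 : ℂ) * I)); ((z : ℂ) * I) * cexp ((p.2 : ℂ) * I), 0]) *
                !![(1 / 2 : ℂ), 1 / 2; 1 / 2, -(1 / 2)])) +
            ∫ p in Ioi (0 : ℝ) ×ˢ Ioc (0 : ℝ) (2 * π),
              f ((!![(1 : ℂ), 1; 1, -1] : Matrix (Fin 2) (Fin 2) ℂ) *
                ((z : ℂ) • (1 : Matrix (Fin 2) (Fin 2) ℂ) + p.1 • Matrix.diagonal ![-((z : ℂ) * I), (z : ℂ) * I] +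
                  p.1 • !![(0 : ℂ), ((z : ℂ) * I) * cexp (-((p.2 : ℂ) * I)); -((z : ℂ) * I) * cexp ((p.2 : ℂ) * I), 0]) *
                !![(1 / 2 : ℂ), 1 / 2; 1 / 2, -(1 / 2)])))) →
      (∀ (f : Matrix (Fin 2) (Fin 2) ℂ → ℂ), Continuous f → HasCompactSupport f → ∀ θ : ℝ,
      Tendsto (fun x : ℝ => |Real.exp x - Real.exp (-x)| •
          ∫ y, descConj (⟨hypBlockGL x θ, hypBlockGL_mem_of_eq_over hJ x θ⟩ : ↥(unitaryGroupOfForm (starRingEnd ℂ) J)) (torusU (starRingEnd ℂ) J)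
            (LineRing.forall_mem_torusU_comm (starRingEnd ℂ) J (hypBlockGL_mem_torusU hJ x θ))
            (fun g : ↥(unitaryGroupOfForm (starRingEnd ℂ) J) => f ((g : GL (Fin 2) ℂ) : Matrix (Fin 2) (Fin 2) ℂ)) y ∂μ₀')
        (𝓝[≠] 0)
        (𝓝 (C₂ • ((∫ p in Ioi (0 : ℝ) ×ˢ Ioc (0 : ℝ) (2 * π),
            f ((!![(1 : ℂ), 1; 1, -1] : Matrix (Fin 2) (Fin 2) ℂ) *
              (Complex.exp ((θ : ℂ) * Complex.I) • (1 : Matrix (Fin 2) (Fin 2) ℂ) +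
                p.1 • Matrix.diagonal ![Complex.exp ((θ : ℂ) * Complex.I) * Complex.I, -(Complex.exp ((θ : ℂ) * Complex.I) * Complex.I)] +
                p.1 • !![(0 : ℂ), -(Complex.exp ((θ : ℂ) * Complex.I) * Complex.I) * Complex.exp (-((p.2 : ℂ) * Complex.I));
                  (Complex.exp ((θ : ℂ) * Complex.I) * Complex.I) * Complex.exp ((p.2 : ℂ) * Complex.I), 0]) *
              !![(1 / 2 : ℂ), 1 / 2; 1 / 2, -(1 / 2)])) +
          ∫ p in Ioi (0 : ℝ) ×ˢ Ioc (0 : ℝ) (2 * π),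
            f ((!![(1 : ℂ), 1; 1, -1] : Matrix (Fin 2) (Fin 2) ℂ) *
              (Complex.exp ((θ : ℂ) * Complex.I) • (1 : Matrix (Fin 2) (Fin 2) ℂ) +
                p.1 • Matrix.diagonal ![-(Complex.exp ((θ : ℂ) * Complex.I) * Complex.I), Complex.exp ((θ : ℂ) * Complex.I) * Complex.I] +
                p.1 • !![(0 : ℂ), (Complex.exp ((θ : ℂ) * Complex.I) * Complex.I) * Complex.exp (-((p.2 : ℂ) * Complex.I));
                  -(Complex.exp ((θ : ℂ) * Complex.I) * Complex.I) * Complex.exp ((p.2 : ℂ) * Complex.I), 0]) *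
              !![(1 / 2 : ℂ), 1 / 2; 1 / 2, -(1 / 2)]))))) →
      (∀ (ρ : Measure ↥(torusU (starRingEnd ℂ) J)) [ρ.IsHaarMeasure] [ρ.IsInvInvariant],
    μ₀' = ρ ((fun p : ℝ × ℝ =>
        (⟨⟨hypBlockGL p.1 p.2, hypBlockGL_mem_of_eq_over hJ p.1 p.2⟩, hypBlockGL_mem_torusU hJ p.1 p.2⟩ : ↥(torusU (starRingEnd ℂ) J))) ''
          (Set.Icc (0 : ℝ) 1 ×ˢ Set.Icc (0 : ℝ) (2 * π))) •
      quotientMeasure (torusU (starRingEnd ℂ) J) ρ (LineRing.isClosed_torusU_two (starRingEnd ℂ) J) μ₀) →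
    ∀ (S : Finset ({w : InfinitePlace L // IsComplex w})) (w : {w : InfinitePlace L // IsComplex w}) (s : {w : InfinitePlace L // IsComplex w} → Fin 3 → ℝ),
      (∀ w' ∈ S, w' ∈ splitChartPlaces L α) → w ∉ S → w ∈ splitChartPlaces L α → HcSemireg S w 0 2 s →
      ∀ a' : ↥(arch (↥(maximalRealSubfield L)) L (IsCMField.complexConj L) 3 (Matrix.diagonal α)) → ℂ, ArchSmooth L 3 (Matrix.diagonal α) a' →
        ContDiffOn ℝ ∞ (orbFamGExt L α ν' a' (insert w S)) (InRegG (slotSign L α) (insert w S)) →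
        HasOneSidedJump (fun ν : ℝ => archERhoG S (s + ν • hcNrm w 0 2) * orbFamGExt L α ν' a' S (s + ν • hcNrm w 0 2))
          ((I * C₁ / C₂ : ℂ) * (archERhoG (insert w S) (hcCayPt w 0 2 s) * orbFamGExt L α ν' a' (insert w S) (hcCayPt w 0 2 s))) := by
  intro L _ _ _ α _ _ ν' _ _ hherm hanis J hJ _ _ _ _ _ _ μ₀ _ _ μ₀' _ _ C₁ C₂ hC₁ hC₂ hK0 hA0 hlink S w₀ s hS hw₀ hwsp hp a' ha' hsm
  -- ### frame facts
  have hα : ∀ i, α i ≠ 0 := ne_zero_of_diagonal_anisotropic hanis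
  have hreal : ∀ (w : {w : InfinitePlace L // IsComplex w}) (i : Fin 3), (w.1.embedding (α i)).im = 0 :=
    fun w i => im_embedding_diagonal_eq_zero L 3 α (complexConj_apply_eq_of_diagonal_frame hherm) w i
  have hS' : ∀ w, w ∈ S → w ∈ splitChartPlaces L α := hS
  obtain ⟨hreal2, hsgn⟩ := blockWeights_of_mem_splitChartPlaces L α w₀ hwsp
  have hs02 : s w₀ 0 = s w₀ 2 := hp.1
  have h01 : Circle.exp (s w₀ 0) ≠ Circle.exp (s w₀ 1) := by
    intro h; have h2 := hp.2.1; rw [hcThird_zero_two] at h2; exact h2 h.symm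
  have hreg : ∀ w, w ≠ w₀ → w ∉ S → Function.Injective fun i : Fin 3 => Circle.exp (s w i) := fun w hne hw => hp.2.2.1 w hw hne
  have hregS : ∀ w, w ∈ S → s w 0 ≠ 0 := hp.2.2.2
  -- ### the test function is ARBITRARY: only continuity and compact support are read by the bricks
  have ha'c : Continuous a' := ha'.continuous
  have ha's : HasCompactSupport a' := ha'.hasCompactSupport
  -- ### (M-UNFOLD) on both charts (★ p850544), opened with `Exists.elim` (large goal)
  refine (exists_continuousMulEquiv_centralizer_gprimeTorus_semireg_cayley_torus L α S w₀ hα hS' hw₀ hwsp s hs02 h01 hreg hregS).elim fun K hK => hK.elim fun e he => ?_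
  have hKc := he.1
  have hKcomm := he.2.2.1
  have h4 := he.2.2.2.1
  have h5 := he.2.2.2.2.1
  have h6 := he.2.2.2.2.2.1
  have hmapT := he.2.2.2.2.2.2.1
  have h5β := he.2.2.2.2.2.2.2.2.2.2.1
  have h6β := he.2.2.2.2.2.2.2.2.2.2.2.1
  have h7β := he.2.2.2.2.2.2.2.2.2.2.2.2
  -- ### (B-STD) package: `φ`, `e′`, `Ψ` (★ `exists_std_package`)
  refine (exists_std_package L α w₀ hJ hreal2 hsgn e _ _ hmapT).elim fun φ hφ => hφ.elim fun e' hY => hY.elim fun Ψ hZ => ?_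
  have hφ := hZ.1
  have hval := hZ.2.1
  have he' := hZ.2.2.1
  have hmapT' := hZ.2.2.2.1
  have hmem := hZ.2.2.2.2.1
  have hΨ := hZ.2.2.2.2.2.2
  -- (B-STD) (iii) for this `φ`
  have hφβ : ∀ (cw : Fin 3 → ℝ) (h : ↥(unitaryGroupOfForm (starRingEnd ℂ) ((Matrix.diagonal ![α (lineOf (formSign L α w₀) 0), α (lineOf (formSign L α w₀) 2)]).map w₀.1.embedding))),
      (((h : ↥(unitaryGroupOfForm (starRingEnd ℂ) ((Matrix.diagonal ![α (lineOf (formSign L α w₀) 0), α (lineOf (formSign L α w₀) 2)]).map w₀.1.embedding))) : GL (Fin 2) ℂ) : Matrix (Fin 2) (Fin 2) ℂ) =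
        (boostStd (formRe L α w₀ ∘ lineOf (formSign L α w₀)) cw).submatrix ![0, 2] ![0, 2] →
      φ h = ⟨hypBlockGL (cw 0) (cw 2), hypBlockGL_mem_of_eq_over hJ (cw 0) (cw 2)⟩ := fun cw h hh =>
    std_eq_hypBlockGL_of_coe_eq_boost w₀.1.embedding ![α (lineOf (formSign L α w₀) 0), α (lineOf (formSign L α w₀) 2)] hJ hsgn φ hval
      (formRe L α w₀ ∘ lineOf (formSign L α w₀)) rfl rfl cw h hh
  -- ### the two chart tori sit inside `Z(γ_s)`
  have hT : chartTorusG L α S ≤ Subgroup.centralizer ({gprimeTorus L α S s} : Set ↥(arch (↥(maximalRealSubfield L)) L (IsCMField.complexConj L) 3 (Matrix.diagonal α))) :=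
    chartTorusG_le_centralizer L α S s
  have hTβ : chartTorusG L α (insert w₀ S) ≤ Subgroup.centralizer ({gprimeTorus L α S s} : Set ↥(arch (↥(maximalRealSubfield L)) L (IsCMField.complexConj L) 3 (Matrix.diagonal α))) := by
    have h := chartTorusG_le_centralizer L α (insert w₀ S) (Function.update s w₀ ![0, s w₀ 1, s w₀ 0])
    rwa [← gprimeTorus_of_wall L α hw₀ hwsp hs02] at h
  -- ### instances on `Z(γ_s)`, the two quotients, `U(J) ⧸ A_J`
  have hZc : IsClosed ((Subgroup.centralizer ({gprimeTorus L α S s} : Set ↥(arch (↥(maximalRealSubfield L)) L (IsCMField.complexConj L) 3 (Matrix.diagonal α)))) :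
      Set ↥(arch (↥(maximalRealSubfield L)) L (IsCMField.complexConj L) 3 (Matrix.diagonal α))) := isClosed_centralizer_singleton_of_t2 _
  haveI : LocallyCompactSpace ↥(Subgroup.centralizer ({gprimeTorus L α S s} : Set ↥(arch (↥(maximalRealSubfield L)) L (IsCMField.complexConj L) 3 (Matrix.diagonal α)))) := hZc.isClosedEmbedding_subtypeVal.locallyCompactSpace
  haveI : SecondCountableTopology ↥(Subgroup.centralizer ({gprimeTorus L α S s} : Set ↥(arch (↥(maximalRealSubfield L)) L (IsCMField.complexConj L) 3 (Matrix.diagonal α)))) := TopologicalSpace.Subtype.secondCountableTopology _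
  letI : MeasurableSpace (↥(Subgroup.centralizer ({gprimeTorus L α S s} : Set ↥(arch (↥(maximalRealSubfield L)) L (IsCMField.complexConj L) 3 (Matrix.diagonal α)))) ⧸ (chartTorusG L α S).subgroupOf (Subgroup.centralizer ({gprimeTorus L α S s} : Set ↥(arch (↥(maximalRealSubfield L)) L (IsCMField.complexConj L) 3 (Matrix.diagonal α))))) := borel _
  haveI : BorelSpace (↥(Subgroup.centralizer ({gprimeTorus L α S s} : Set ↥(arch (↥(maximalRealSubfield L)) L (IsCMField.complexConj L) 3 (Matrix.diagonal α)))) ⧸ (chartTorusG L α S).subgroupOf (Subgroup.centralizer ({gprimeTorus L α S s} : Set ↥(arch (↥(maximalRealSubfield L)) L (IsCMField.complexConj L) 3 (Matrix.diagonal α))))) := ⟨rfl⟩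
  letI : MeasurableSpace (↥(Subgroup.centralizer ({gprimeTorus L α S s} : Set ↥(arch (↥(maximalRealSubfield L)) L (IsCMField.complexConj L) 3 (Matrix.diagonal α)))) ⧸ (chartTorusG L α (insert w₀ S)).subgroupOf (Subgroup.centralizer ({gprimeTorus L α S s} : Set ↥(arch (↥(maximalRealSubfield L)) L (IsCMField.complexConj L) 3 (Matrix.diagonal α))))) := borel _
  haveI : BorelSpace (↥(Subgroup.centralizer ({gprimeTorus L α S s} : Set ↥(arch (↥(maximalRealSubfield L)) L (IsCMField.complexConj L) 3 (Matrix.diagonal α)))) ⧸ (chartTorusG L α (insert w₀ S)).subgroupOf (Subgroup.centralizer ({gprimeTorus L α S s} : Set ↥(arch (↥(maximalRealSubfield L)) L (IsCMField.complexConj L) 3 (Matrix.diagonal α))))) := ⟨rfl⟩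
  letI : MeasurableSpace (↥(unitaryGroupOfForm (starRingEnd ℂ) J) ⧸ Subgroup.map (φ : ↥(unitaryGroupOfForm (starRingEnd ℂ) ((Matrix.diagonal ![α (lineOf (formSign L α w₀) 0), α (lineOf (formSign L α w₀) 2)]).map w₀.1.embedding)) →* ↥(unitaryGroupOfForm (starRingEnd ℂ) J)) ((circleDiagonal 2).codRestrict (unitaryGroupOfForm (starRingEnd ℂ) ((Matrix.diagonal ![α (lineOf (formSign L α w₀) 0), α (lineOf (formSign L α w₀) 2)]).map w₀.1.embedding)) (circleDiagonal_mem_archLocal_diagonal L 2 ![α (lineOf (formSign L α w₀) 0), α (lineOf (formSign L α w₀) 2)] w₀)).range) := borel _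
  haveI : BorelSpace (↥(unitaryGroupOfForm (starRingEnd ℂ) J) ⧸ Subgroup.map (φ : ↥(unitaryGroupOfForm (starRingEnd ℂ) ((Matrix.diagonal ![α (lineOf (formSign L α w₀) 0), α (lineOf (formSign L α w₀) 2)]).map w₀.1.embedding)) →* ↥(unitaryGroupOfForm (starRingEnd ℂ) J)) ((circleDiagonal 2).codRestrict (unitaryGroupOfForm (starRingEnd ℂ) ((Matrix.diagonal ![α (lineOf (formSign L α w₀) 0), α (lineOf (formSign L α w₀) 2)]).map w₀.1.embedding)) (circleDiagonal_mem_archLocal_diagonal L 2 ![α (lineOf (formSign L α w₀) 0), α (lineOf (formSign L α w₀) 2)] w₀)).range) := ⟨rfl⟩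
  haveI : CompactSpace ↥(Subgroup.map (φ : ↥(unitaryGroupOfForm (starRingEnd ℂ) ((Matrix.diagonal ![α (lineOf (formSign L α w₀) 0), α (lineOf (formSign L α w₀) 2)]).map w₀.1.embedding)) →* ↥(unitaryGroupOfForm (starRingEnd ℂ) J)) ((circleDiagonal 2).codRestrict (unitaryGroupOfForm (starRingEnd ℂ) ((Matrix.diagonal ![α (lineOf (formSign L α w₀) 0), α (lineOf (formSign L α w₀) 2)]).map w₀.1.embedding)) (circleDiagonal_mem_archLocal_diagonal L 2 ![α (lineOf (formSign L α w₀) 0), α (lineOf (formSign L α w₀) 2)] w₀)).range) := isCompact_iff_compactSpace.mp (isCompact_map_circleDiagonal_range L α w₀ φ)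
  have hAcomm : ∀ a b : ↥(Subgroup.map (φ : ↥(unitaryGroupOfForm (starRingEnd ℂ) ((Matrix.diagonal ![α (lineOf (formSign L α w₀) 0), α (lineOf (formSign L α w₀) 2)]).map w₀.1.embedding)) →* ↥(unitaryGroupOfForm (starRingEnd ℂ) J)) ((circleDiagonal 2).codRestrict (unitaryGroupOfForm (starRingEnd ℂ) ((Matrix.diagonal ![α (lineOf (formSign L α w₀) 0), α (lineOf (formSign L α w₀) 2)]).map w₀.1.embedding)) (circleDiagonal_mem_archLocal_diagonal L 2 ![α (lineOf (formSign L α w₀) 0), α (lineOf (formSign L α w₀) 2)] w₀)).range), a * b = b * a := by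
    rintro ⟨_, ⟨x, ⟨u, rfl⟩, rfl⟩⟩ ⟨_, ⟨y, ⟨v, rfl⟩, rfl⟩⟩
    apply Subtype.ext
    show (φ : ↥(unitaryGroupOfForm (starRingEnd ℂ) ((Matrix.diagonal ![α (lineOf (formSign L α w₀) 0), α (lineOf (formSign L α w₀) 2)]).map w₀.1.embedding)) →* ↥(unitaryGroupOfForm (starRingEnd ℂ) J)) _ * (φ : ↥(unitaryGroupOfForm (starRingEnd ℂ) ((Matrix.diagonal ![α (lineOf (formSign L α w₀) 0), α (lineOf (formSign L α w₀) 2)]).map w₀.1.embedding)) →* ↥(unitaryGroupOfForm (starRingEnd ℂ) J)) _ =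
      (φ : ↥(unitaryGroupOfForm (starRingEnd ℂ) ((Matrix.diagonal ![α (lineOf (formSign L α w₀) 0), α (lineOf (formSign L α w₀) 2)]).map w₀.1.embedding)) →* ↥(unitaryGroupOfForm (starRingEnd ℂ) J)) _ * (φ : ↥(unitaryGroupOfForm (starRingEnd ℂ) ((Matrix.diagonal ![α (lineOf (formSign L α w₀) 0), α (lineOf (formSign L α w₀) 2)]).map w₀.1.embedding)) →* ↥(unitaryGroupOfForm (starRingEnd ℂ) J)) _
    rw [← map_mul, ← map_mul, ← map_mul, ← map_mul, mul_comm u v]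
  -- ### a right- and inversion-invariant Haar measure on `Z(γ_s)` ((h))
  obtain ⟨νM, hνM1, hνM2, hνM3⟩ := exists_isHaarMeasure_isMulRightInvariant_isInvInvariant_centralizer_arch (↥(maximalRealSubfield L)) L (IsCMField.complexConj L) 3
    (Matrix.diagonal α) ({gprimeTorus L α S s} : Set ↥(arch (↥(maximalRealSubfield L)) L (IsCMField.complexConj L) 3 (Matrix.diagonal α))) K hKc hKcomm e' μ₀
  haveI := hνM1; haveI := hνM2; haveI := hνM3
  -- ### the torus clauses `hγ` (★ p850492), `hγβ` (★ p850685)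
  have hγ := eM_gprimeTorus_add_smul_hcNrm_eq L α S w₀ s K e h5 h6 hJ φ (fun u _ => hφ u) e' he' hs02
  have hγβ := eM_gprimeTorus_insert_cayRay_eq L α S w₀ s hw₀ hwsp hs02 K e h6 (formRe L α w₀ ∘ lineOf (formSign L α w₀)) h5β h6β hJ φ hφβ e' he'
  -- [5β] through `φ` (LH3-p03's `h5β` binder)
  have h5β' : ∀ c : {w : InfinitePlace L // IsComplex w} → Fin 3 → ℝ,
      (e' ⟨gprimeTorus L α (insert w₀ S) c, gprimeTorus_insert_mem_centralizer L α hw₀ hwsp hs02 c⟩).1 =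
        ⟨hypBlockGL (c w₀ 0) (c w₀ 2), hypBlockGL_mem_of_eq_over hJ (c w₀ 0) (c w₀ 2)⟩ := fun c => by
    rw [he']
    exact hφβ (c w₀) _ (h5β c)
  -- ### the eventual binders on both charts (★ p850667, ★ p850695) and ONE cut-off `β` for both
  obtain ⟨CS, hCSc, hCMν, hintν⟩ := exists_blockNormal_binders L α S w₀ s ν' hα hreal hS' hw₀ hp ha'c ha's
  obtain ⟨CB, hCBc, hCMx, hintx⟩ := exists_cayRay_binders L α S w₀ s ν' hα hS' hw₀ hwsp hp ha'c ha's
  obtain ⟨β, hβc, hβs, hβ0, -, hβ1⟩ := exists_continuous_hasCompactSupport_integral_comp_mul_eq_one_pos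
    (Subgroup.centralizer ({gprimeTorus L α S s} : Set ↥(arch (↥(maximalRealSubfield L)) L (IsCMField.complexConj L) 3 (Matrix.diagonal α)))) hZc νM
    ((hCSc.union hCBc).insert 1)
  have hβ1S : ∀ x ∈ CS, ∀ k₀ : ↥(Subgroup.centralizer ({gprimeTorus L α S s} : Set ↥(arch (↥(maximalRealSubfield L)) L (IsCMField.complexConj L) 3 (Matrix.diagonal α)))), ∫ h : ↥(Subgroup.centralizer ({gprimeTorus L α S s} : Set ↥(arch (↥(maximalRealSubfield L)) L (IsCMField.complexConj L) 3 (Matrix.diagonal α)))), β (x * (k₀ : ↥(arch (↥(maximalRealSubfield L)) L (IsCMField.complexConj L) 3 (Matrix.diagonal α))) *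
      (h : ↥(arch (↥(maximalRealSubfield L)) L (IsCMField.complexConj L) 3 (Matrix.diagonal α)))) ∂νM = 1 :=
    fun x hx k₀ => hβ1 x (Set.mem_insert_of_mem _ (Set.mem_union_left _ hx)) k₀
  have hβ1B : ∀ x ∈ CB, ∀ k₀ : ↥(Subgroup.centralizer ({gprimeTorus L α S s} : Set ↥(arch (↥(maximalRealSubfield L)) L (IsCMField.complexConj L) 3 (Matrix.diagonal α)))), ∫ h : ↥(Subgroup.centralizer ({gprimeTorus L α S s} : Set ↥(arch (↥(maximalRealSubfield L)) L (IsCMField.complexConj L) 3 (Matrix.diagonal α)))), β (x * (k₀ : ↥(arch (↥(maximalRealSubfield L)) L (IsCMField.complexConj L) 3 (Matrix.diagonal α))) *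
      (h : ↥(arch (↥(maximalRealSubfield L)) L (IsCMField.complexConj L) 3 (Matrix.diagonal α)))) ∂νM = 1 :=
    fun x hx k₀ => hβ1 x (Set.mem_insert_of_mem _ (Set.mem_union_right _ hx)) k₀
  -- ### a box-positive inversion-invariant Haar measure on the split torus, and `μ₀′ ≠ 0`
  have hTUc : IsClosed ((torusU (starRingEnd ℂ) J : Subgroup ↥(unitaryGroupOfForm (starRingEnd ℂ) J)) : Set ↥(unitaryGroupOfForm (starRingEnd ℂ) J)) :=
    LineRing.isClosed_torusU_two _ _
  haveI : LocallyCompactSpace ↥(torusU (starRingEnd ℂ) J) := hTUc.isClosedEmbedding_subtypeVal.locallyCompactSpace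
  haveI : SecondCountableTopology ↥(torusU (starRingEnd ℂ) J) := TopologicalSpace.Subtype.secondCountableTopology _
  obtain ⟨σ, hσ⟩ : ∃ σ : Measure ↥(torusU (starRingEnd ℂ) J), σ.IsHaarMeasure := ⟨Measure.haar, inferInstance⟩
  haveI : σ.IsInvInvariant := isInvInvariant_of_comm _ hTUc (fun x hx y hy => LineRing.forall_mem_torusU_comm (starRingEnd ℂ) J hy x hx) σ
  have hσ0 := measure_boxStd_ne_zero hJ σ
  have hσt := (measure_boxStd_lt_top hJ σ).ne
  -- ### (b2) the Cayley torus bookkeeping: `e′(T♯′) = T_split × ⊤`, `Ψβ`, `hTAβ` (★ p850743)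
  obtain ⟨hTAβ, -, Ψβ, -, hΨβ⟩ := hTAβ_package_semireg_std L α S w₀ hw₀ hwsp s hs02 K e h5β h7β hJ hsgn φ hval e' he'
  have hTA : ∀ g : ↥(Subgroup.centralizer ({gprimeTorus L α S s} : Set ↥(arch (↥(maximalRealSubfield L)) L (IsCMField.complexConj L) 3 (Matrix.diagonal α)))), g ∈ (chartTorusG L α S).subgroupOf (Subgroup.centralizer ({gprimeTorus L α S s} : Set ↥(arch (↥(maximalRealSubfield L)) L (IsCMField.complexConj L) 3 (Matrix.diagonal α)))) ↔ (e' g).1 ∈ Subgroup.map (φ : ↥(unitaryGroupOfForm (starRingEnd ℂ) ((Matrix.diagonal ![α (lineOf (formSign L α w₀) 0), α (lineOf (formSign L α w₀) 2)]).map w₀.1.embedding)) →* ↥(unitaryGroupOfForm (starRingEnd ℂ) J)) ((circleDiagonal 2).codRestrict (unitaryGroupOfForm (starRingEnd ℂ) ((Matrix.diagonal ![α (lineOf (formSign L α w₀) 0), α (lineOf (formSign L α w₀) 2)]).map w₀.1.embedding)) (circleDiagonal_mem_archLocal_diagonal L 2 ![α (lineOf (formSign L α w₀) 0), α (lineOf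 (formSign L α w₀) 2)] w₀)).range :=
    fun g => mem_iff_fst_mem_of_map_eq_prod_top _ _ e' hmapT' g
  -- ### (G′-CANCEL): the two descent constants against the shared `μ₀`, `μ₀′` AGREE (★ p850673)
  obtain ⟨κ, κβ, hκ, hκβ, hmap, hmapβ, hKK⟩ := exists_hmap_hmapβ_descentConst_eq_of_clauses L α S w₀ s hw₀ hwsp hs02 hT hTβ νM hJ μ₀ μ₀' hlink σ hσ0 hσt
    (Subgroup.map (φ : ↥(unitaryGroupOfForm (starRingEnd ℂ) ((Matrix.diagonal ![α (lineOf (formSign L α w₀) 0), α (lineOf (formSign L α w₀) 2)]).map w₀.1.embedding)) →* ↥(unitaryGroupOfForm (starRingEnd ℂ) J)) ((circleDiagonal 2).codRestrict (unitaryGroupOfForm (starRingEnd ℂ) ((Matrix.diagonal ![α (lineOf (formSign L α w₀) 0), α (lineOf (formSign L α w₀) 2)]).map w₀.1.embedding)) (circleDiagonal_mem_archLocal_diagonal L 2 ![α (lineOf (formSign L α w₀) 0), α (lineOf (formSign L α w₀) 2)] w₀)).range) hAcomm K hKc hKcomm e h4 h5 h6 h6β φ e' he' h5β' hTA hTAβ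 Ψ hΨ Ψβ hΨβ
  -- ### (J-G′-BLOCK) on the compact chart: ONE block test function `f_B` and `hdesc` (★ p850417)
  refine (exists_block_testFunction_chartOrbG_eventuallyEq L α ν' a' S w₀ s (gprimeTorus L α S s) hT (Subgroup.map (φ : ↥(unitaryGroupOfForm (starRingEnd ℂ) ((Matrix.diagonal ![α (lineOf (formSign L α w₀) 0), α (lineOf (formSign L α w₀) 2)]).map w₀.1.embedding)) →* ↥(unitaryGroupOfForm (starRingEnd ℂ) J)) ((circleDiagonal 2).codRestrict (unitaryGroupOfForm (starRingEnd ℂ) ((Matrix.diagonal ![α (lineOf (formSign L α w₀) 0), α (lineOf (formSign L α w₀) 2)]).map w₀.1.embedding)) (circleDiagonal_mem_archLocal_diagonal L 2 ![α (lineOf (formSign L α w₀) 0), α (lineOf (formSign L α w₀) 2)] w₀)).range) e' Ψ hΨ μ₀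
    (fun ν : ℝ => (⟨Matrix.GeneralLinearGroup.mkOfDetNeZero !![(1 : ℂ), 1; 1, -1] det_cayleyTwo_ne_zero *
        circleDiagonal 2 ![Circle.exp (s w₀ 0) * Circle.exp ν, Circle.exp (s w₀ 0) * Circle.exp (-ν)] *
        (Matrix.GeneralLinearGroup.mkOfDetNeZero !![(1 : ℂ), 1; 1, -1] det_cayleyTwo_ne_zero)⁻¹, cayley_conj_circleDiagonal_mem_of_eq_over hJ _⟩ : ↥(unitaryGroupOfForm (starRingEnd ℂ) J)))
    (e ⟨gprimeTorus L α S s, gprimeTorus_mem_centralizer L α S s s⟩).2 hγ νM ha'c ha's hβc hβs hβ0 hβ1S hCMν hintν hmap).elim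
    fun fB hfB => ?_
  have hfBc := hfB.1
  have hfBs := hfB.2.1
  have hfBdef := hfB.2.2.1
  have hdesc := hfB.2.2.2
  -- an ambient extension `f` of `f_B` (Tietze, ★ p850353) and the (K0) jump from the SHARED `(μ₀, C₁)` (★ §5)
  obtain ⟨f, hf, hfc, hfF⟩ := exists_continuous_hasCompactSupport_extend hJ fB hfBc hfBs
  have hjump := hasOneSidedJump_two_sin_mul_integral_block_of_sharedK0 hJ μ₀ hK0 fB f hf hfc hfF (s w₀ 0)
  have hfF' : ∀ g : ↥(unitaryGroupOfForm (starRingEnd ℂ) J), f ((g : GL (Fin 2) ℂ) : Matrix (Fin 2) (Fin 2) ℂ) =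
      (fun m : ↥(Subgroup.centralizer ({gprimeTorus L α S s} : Set ↥(arch (↥(maximalRealSubfield L)) L (IsCMField.complexConj L) 3 (Matrix.diagonal α)))) => ∫ x', β x' • a' (x' * (m : ↥(arch (↥(maximalRealSubfield L)) L (IsCMField.complexConj L) 3 (Matrix.diagonal α))) * x'⁻¹) ∂ν')
        (e'.symm (g, (e ⟨gprimeTorus L α S s, gprimeTorus_mem_centralizer L α S s s⟩).2)) := fun g => by
    rw [hfF, hfBdef]
  -- ### the Cayley-chart limit `hray` and its non-vanishing, in the SHARED currency (★ p850689)
  have hray := tendsto_absSub_mul_chartOrbG_xRay_descended_of_cutoff_shared L α ν' a' S w₀ s (gprimeTorus L α S s) hTβ hJ μ₀' e' Ψβ hΨβ (s w₀ 0)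
    (e ⟨gprimeTorus L α S s, gprimeTorus_mem_centralizer L α S s s⟩).2 hγβ νM ha'c ha's hβc hβs hβ0 hβ1B hCMx hintx hmapβ hA0 f hf hfc hfF'
  -- ### ONE descent constant: `dt′_S·κ = dt′♯·κβ` ((G′-CANCEL))
  have hKK' : (((haveI := isHaarMeasure_chartHaarG L α (insert w₀ S); chartHaarG L α (insert w₀ S) (chartBoxImgG L α (insert w₀ S)))).toReal : ℂ) * ((κβ : ℝ) : ℂ) =
      (((haveI := isHaarMeasure_chartHaarG L α S; chartHaarG L α S (chartBoxImgG L α S))).toReal : ℂ) * ((κ : ℝ) : ℂ) := by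
    rw [← Complex.ofReal_mul, ← Complex.ofReal_mul, hKK]
  -- ### the division-free (JG′) head of §1, read by continuity from the ray
  exact hasOneSidedJump_orbFamGExt_jump_of_cayRay_std L α ν' a' hS' hw₀ hwsp hp hdesc hjump rfl (by rw [hKK']) hC₂.ne' hsm hray

/-! ## §3 The other noncompact pairs: reflection `ν ↦ −ν` and the realised compact Weyl reflection `(0 1)` -/

section Generic

variable {W : Type*} [Fintype W] [DecidableEq W]

omit [Fintype W] in
/-- The wall normal of the reversed pair is the opposite vector: `hcNrm w j i = −hcNrm w i j`. [cite: Shelstad1979, §4 p. 25] -/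
theorem hcNrm_swap (w : W) (i j : Fin 3) : hcNrm w j i = -hcNrm w i j := by
  rw [hcNrm, hcNrm, ← Pi.single_neg, neg_sub]

omit [Fintype W] in
/-- The Cayley point does not see the order of the pair: `hcCayPt w j i = hcCayPt w i j`. [cite: Shelstad1979, §4 p. 25] -/
theorem hcCayPt_swap (w : W) (i j : Fin 3) (c : W → Fin 3 → ℝ) : hcCayPt w j i c = hcCayPt w i j c := by
  rw [hcCayPt, hcCayPt, hcThird_comm j i, add_comm (c w j)]

omit [Fintype W] [DecidableEq W] in
/-- Semiregularity does not see the order of the pair. [cite: Shelstad1979, §4 p. 22] -/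
theorem HcSemireg.pair_swap {S' : Finset W} {w : W} {i j : Fin 3} {p : W → Fin 3 → ℝ} (h : HcSemireg S' w i j p) : HcSemireg S' w j i p := by
  refine ⟨h.1.symm, ?_, h.2.2⟩
  rw [hcThird_comm j i, ← h.1]
  exact h.2.1

omit [Fintype W] in
/-- **A JUMP ALONG `hcNrm w i j` IS MINUS THE JUMP ALONG `hcNrm w j i`** (same base point, any function of the chart coordinates). [cite: Shelstad1979, §4 Lemma 4.3 p. 25] -/
theorem hasOneSidedJump_pair_swap {G : (W → Fin 3 → ℝ) → ℂ} {w : W} {i j : Fin 3} {p : W → Fin 3 → ℝ} {J : ℂ}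
    (h : HasOneSidedJump (fun ν : ℝ => G (p + ν • hcNrm w i j)) J) : HasOneSidedJump (fun ν : ℝ => G (p + ν • hcNrm w j i)) (-J) := by
  have h' := hasOneSidedJump_comp_neg h
  refine (funext fun ν => ?_ : (fun ν : ℝ => G (p + -ν • hcNrm w i j)) = fun ν : ℝ => G (p + ν • hcNrm w j i)) ▸ h'
  rw [hcNrm_swap w i j, smul_neg, neg_smul]

/-- **THE TWISTED NORMALISER `e^{ρ}_{S′}·R′_{S′}` IS ODD UNDER THE REALISED COMPACT REFLECTION `(0 1)`** at a compact place `w ∉ S′`: at `w`,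
`e^{i(θ₁−θ₂)}(1−e^{i(θ₀−θ₁)})(1−e^{i(θ₂−θ₁)})(1−e^{i(θ₂−θ₀)}) = −e^{i(θ₀−θ₂)}(1−e^{i(θ₁−θ₀)})(1−e^{i(θ₂−θ₀)})(1−e^{i(θ₂−θ₁)})`; the other places are untouched.
(Harish-Chandra's `e^{ρ}Δ` transforms by the sign character of the compact Weyl group.) [cite: Shelstad1979, §4 property (II) p. 23; p. 24] [cite: Varadarajan1977, I §1.12] -/
theorem archERhoG_mul_archRG_hcSwapAt_zero_one (S' : Finset W) {w : W} (hw : w ∉ S') (c : W → Fin 3 → ℝ) :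
    archERhoG S' (hcSwapAt w 0 1 c) * archRG S' (hcSwapAt w 0 1 c) = -(archERhoG S' c * archRG S' c) := by
  have hrest : ∏ w' ∈ Finset.univ.erase w,
      ((if w' ∈ S' then (1 : ℂ) else (Circle.exp (hcSwapAt w 0 1 c w' 0 - hcSwapAt w 0 1 c w' 2) : ℂ)) *
        (if w' ∈ S' then
            ((|Real.exp (hcSwapAt w 0 1 c w' 0) - Real.exp (-hcSwapAt w 0 1 c w' 0)| *
              ‖Complex.exp (hcSwapAt w 0 1 c w' 0 + hcSwapAt w 0 1 c w' 2 * I) - Complex.exp (hcSwapAt w 0 1 c w' 1 * I)‖ *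
                ‖Complex.exp (-hcSwapAt w 0 1 c w' 0 + hcSwapAt w 0 1 c w' 2 * I) - Complex.exp (hcSwapAt w 0 1 c w' 1 * I)‖ : ℝ) : ℂ)
          else (1 - (Circle.exp (hcSwapAt w 0 1 c w' 1 - hcSwapAt w 0 1 c w' 0) : ℂ)) * (1 - (Circle.exp (hcSwapAt w 0 1 c w' 2 - hcSwapAt w 0 1 c w' 0) : ℂ)) *
            (1 - (Circle.exp (hcSwapAt w 0 1 c w' 2 - hcSwapAt w 0 1 c w' 1) : ℂ)))) =
      ∏ w' ∈ Finset.univ.erase w,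
      ((if w' ∈ S' then (1 : ℂ) else (Circle.exp (c w' 0 - c w' 2) : ℂ)) *
        (if w' ∈ S' then
            ((|Real.exp (c w' 0) - Real.exp (-c w' 0)| *
              ‖Complex.exp (c w' 0 + c w' 2 * I) - Complex.exp (c w' 1 * I)‖ * ‖Complex.exp (-c w' 0 + c w' 2 * I) - Complex.exp (c w' 1 * I)‖ : ℝ) : ℂ)
          else (1 - (Circle.exp (c w' 1 - c w' 0) : ℂ)) * (1 - (Circle.exp (c w' 2 - c w' 0) : ℂ)) * (1 - (Circle.exp (c w' 2 - c w' 1) : ℂ)))) := by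
    refine Finset.prod_congr rfl fun w' hw' => ?_
    rw [hcSwapAt_apply_of_ne (Finset.ne_of_mem_erase hw')]
  -- the place-`w` identity: a polynomial identity in the three unit complex numbers `e^{iθ_l}`
  have key : (Circle.exp (c w 1 - c w 2) : ℂ) * ((1 - (Circle.exp (c w 0 - c w 1) : ℂ)) * (1 - (Circle.exp (c w 2 - c w 1) : ℂ)) * (1 - (Circle.exp (c w 2 - c w 0) : ℂ))) =
      -((Circle.exp (c w 0 - c w 2) : ℂ) * ((1 - (Circle.exp (c w 1 - c w 0) : ℂ)) * (1 - (Circle.exp (c w 2 - c w 0) : ℂ)) * (1 - (Circle.exp (c w 2 - c w 1) : ℂ)))) := by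
    simp only [Circle.coe_exp, Complex.ofReal_sub, sub_mul, Complex.exp_sub]
    have h0 : Complex.exp ((c w 0 : ℂ) * I) ≠ 0 := Complex.exp_ne_zero _
    have h1 : Complex.exp ((c w 1 : ℂ) * I) ≠ 0 := Complex.exp_ne_zero _
    have h2 : Complex.exp ((c w 2 : ℂ) * I) ≠ 0 := Complex.exp_ne_zero _
    field_simp
    ring
  rw [archERhoG_mul_archRG_eq_mul_prod_erase S' (hcSwapAt w 0 1 c) w, archERhoG_mul_archRG_eq_mul_prod_erase S' c w, hrest, if_neg hw, if_neg hw,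
    if_neg hw, if_neg hw, (hcSwapAt_apply_pair w 0 1 c).1, (hcSwapAt_apply_pair w 0 1 c).2,
    hcSwapAt_apply_self_of_ne w (show (2 : Fin 3) ≠ 0 by decide) (show (2 : Fin 3) ≠ 1 by decide), key, neg_mul]

/-- **CONSEQUENCE FOR A (W)-SYMMETRIC FAMILY**: off the walls, the TWISTED members satisfy `(e^{ρ}F)(c) = −(e^{ρ}F)(σc)` for the realised swap `σ = (0 1)` at a compact place with
`s w 0 = s w 1` (★ `ArchHcWeyl` + the oddness of `e^{ρ}R′`; `R′(σc) ≠ 0` on `RegG`). [cite: Shelstad1979, §4 property (II) p. 23; p. 24] -/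
theorem archERhoG_mul_eq_neg_hcSwapAt_of_archHcWeyl {s : W → Fin 3 → SignType} {F : Finset W → (W → Fin 3 → ℝ) → ℂ} (hW : ArchHcWeyl s F)
    {S' : Finset W} {w : W} (hw : w ∉ S') (hs : s w 0 = s w 1) {c : W → Fin 3 → ℝ} (hc : hcSwapAt w 0 1 c ∈ RegG S') :
    archERhoG S' c * F S' c = -(archERhoG S' (hcSwapAt w 0 1 c) * F S' (hcSwapAt w 0 1 c)) := by
  have hWc := hW.1 S' c w 0 1 hw (by decide) hs
  have h31 := archERhoG_mul_archRG_hcSwapAt_zero_one S' hw c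
  have hR : archRG S' (hcSwapAt w 0 1 c) ≠ 0 := archRG_ne_zero_of_mem_regG hc
  apply mul_right_cancel₀ hR
  linear_combination (-archERhoG S' c) * hWc + F S' (hcSwapAt w 0 1 c) * h31

omit [Fintype W] in
/-- The swap `(0 1)` carries the normal line of the wall `(1,2)` through `p` onto the normal line of the wall `(0,2)` through `σp`. [cite: Shelstad1979, §4 p. 23; p. 25] -/
theorem hcSwapAt_zero_one_add_smul_hcNrm_one_two (w : W) (p : W → Fin 3 → ℝ) (ν : ℝ) :
    hcSwapAt w 0 1 (p + ν • hcNrm w 1 2) = hcSwapAt w 0 1 p + ν • hcNrm w 0 2 := by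
  rw [hcSwapAt_add_smul, hcNrm, hcSwapAt_single_self, hcNrm]
  congr 3
  funext l
  fin_cases l <;> simp [Equiv.swap_apply_of_ne_of_ne (a := (0 : Fin 3)) (b := 1) (x := 2) (by decide) (by decide)]

omit [Fintype W] in
/-- The Cayley point of the wall `(1,2)` at `p` is the Cayley point of the wall `(0,2)` at `σp`. [cite: Shelstad1979, §4 p. 25] -/
theorem hcCayPt_one_two_eq_hcCayPt_zero_two_hcSwapAt (w : W) (p : W → Fin 3 → ℝ) : hcCayPt w 1 2 p = hcCayPt w 0 2 (hcSwapAt w 0 1 p) := by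
  rw [hcCayPt, hcCayPt, hcThird_one_two, hcThird_zero_two, (hcSwapAt_apply_pair w 0 1 p).1, (hcSwapAt_apply_pair w 0 1 p).2,
    hcSwapAt_apply_self_of_ne w (show (2 : Fin 3) ≠ 0 by decide) (show (2 : Fin 3) ≠ 1 by decide), hcSwapAt, Function.update_idem]

omit [Fintype W] in
/-- A semiregular point of the wall `(1,2)` is carried by `σ = (0 1)` to a semiregular point of the wall `(0,2)`. [cite: Shelstad1979, §4 p. 22] -/
theorem HcSemireg.hcSwapAt_zero_one {S' : Finset W} {w : W} (hw : w ∉ S') {p : W → Fin 3 → ℝ} (hp : HcSemireg S' w 1 2 p) : HcSemireg S' w 0 2 (hcSwapAt w 0 1 p) := by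
  obtain ⟨h12, h3, hreg, hsplit⟩ := hp
  refine ⟨?_, ?_, fun w' hw' hne => ?_, fun w' hw' => ?_⟩
  · rw [(hcSwapAt_apply_pair w 0 1 p).1, hcSwapAt_apply_self_of_ne w (show (2 : Fin 3) ≠ 0 by decide) (show (2 : Fin 3) ≠ 1 by decide)]
    exact h12
  · rw [hcThird_zero_two, (hcSwapAt_apply_pair w 0 1 p).1, (hcSwapAt_apply_pair w 0 1 p).2]
    rw [hcThird_one_two] at h3
    exact h3
  · simp only [hcSwapAt_apply_of_ne hne]
    exact hreg w' hw' hne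
  · rw [hcSwapAt_apply_of_ne (ne_of_mem_of_not_mem hw' hw)]
    exact hsplit w' hw'

/-- **THE `(1,2)`-WALL JUMP FROM THE `(0,2)`-WALL JUMP** for a (W)-symmetric family: if the twisted member jumps by `J` along the normal of `(0,2)` at `σp`, it jumps by `−J` along the
normal of `(1,2)` at `p` (`(e^{ρ}F)(p + ν·n₁₂) = −(e^{ρ}F)(σp + ν·n₀₂)` for small `ν ≠ 0`). [cite: Shelstad1979, §4 property (II) p. 23; Prop. 4.5 (p. 26)] -/
theorem hasOneSidedJump_wall_one_two_of_zero_two {s : W → Fin 3 → SignType} {F : Finset W → (W → Fin 3 → ℝ) → ℂ} (hW : ArchHcWeyl s F)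
    {S' : Finset W} {w : W} (hw : w ∉ S') (hs : s w 0 = s w 1) {p : W → Fin 3 → ℝ} (hp : HcSemireg S' w 1 2 p) {J : ℂ}
    (h02 : HasOneSidedJump (fun ν : ℝ => archERhoG S' (hcSwapAt w 0 1 p + ν • hcNrm w 0 2) * F S' (hcSwapAt w 0 1 p + ν • hcNrm w 0 2)) J) :
    HasOneSidedJump (fun ν : ℝ => archERhoG S' (p + ν • hcNrm w 1 2) * F S' (p + ν • hcNrm w 1 2)) (-J) := by
  have hev : (fun ν : ℝ => archERhoG S' (p + ν • hcNrm w 1 2) * F S' (p + ν • hcNrm w 1 2)) =ᶠ[𝓝[≠] (0 : ℝ)]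
      fun ν : ℝ => -(archERhoG S' (hcSwapAt w 0 1 p + ν • hcNrm w 0 2) * F S' (hcSwapAt w 0 1 p + ν • hcNrm w 0 2)) := by
    filter_upwards [eventually_add_smul_hcNrm_mem_regG hw (show (1 : Fin 3) ≠ 2 by decide) hp] with ν hν
    rw [← hcSwapAt_zero_one_add_smul_hcNrm_one_two]
    exact archERhoG_mul_eq_neg_hcSwapAt_of_archHcWeyl hW hw hs ((hcSwapAt_mem_regG_iff S' hw 0 1 _).2 hν)
  obtain ⟨Lp, Lm, h1, h2, h3⟩ := h02
  refine (hasOneSidedJump_congr hev (-J)).2 ⟨-Lp, -Lm, h1.neg, h2.neg, by rw [← h3]; ring⟩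

omit [Fintype W] [DecidableEq W] in
/-- **The noncompact ordered pairs of a slot pattern with `s w 0 = s w 1`** are `(0,2)`, `(2,0)`, `(1,2)`, `(2,1)` (the guard `s w i ≠ s w j` of ★ `ArchHcJump` excludes the compact
pair `{0, 1}`). [cite: Shelstad1979, §4 p. 23] [cite: Rogawski1990, §14.2 p. 232] -/
theorem noncompactPair_cases {s : W → Fin 3 → SignType} {w : W} (hs : s w 0 = s w 1) {i j : Fin 3} (hij : i ≠ j) (hsij : s w i ≠ s w j) :
    (i = 0 ∧ j = 2) ∨ (i = 2 ∧ j = 0) ∨ (i = 1 ∧ j = 2) ∨ (i = 2 ∧ j = 1) := by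
  fin_cases i <;> fin_cases j <;> simp_all

end Generic


/-! ## §4 The head: (I₃) at order 0 for `orbFamGExt`, every noncompact pair, with the closed jump constant `ε i j · (i·C₁∕C₂)` -/

/-- **(I₃)₀ — THE ORDER-0 UNIVERSAL JUMP OF THE TWISTED EXTENDED GENUINE FAMILY** (the conclusion of ★ `ArchHcJump.order_zero` for `F := orbFamGExt L α ν′ a′`, constant FIXED).
Under the frame hypotheses and the SHARED rank-one datum of ★ p850798 (binder block verbatim), for every `a′ ∈ C_c^∞(G′_∞)` whose extended family satisfies the letter's clause (I₂)
(`hI₂`, chart-wise `ContDiffOn` on `InRegG`; the (A5) head), every chart `S′`, compact place `w ∉ S′`, NONCOMPACT ordered pair `i ≠ j` (`slotSign w i ≠ slotSign w j`) and semiregular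
wall point `p`:  `ν ↦ (e^{ρ}_{S′} · orbFamGExt ν′ a′ S′)(p + ν • hcNrm w i j)` has both one-sided limits at `ν = 0` and jumps by
**`(ε i j · i·C₁∕C₂) · (e^{ρ}_{S′∪w} · orbFamGExt ν′ a′ (S′∪w))(hcCayPt w i j p)`, `ε 0 2 = ε 2 1 = 1`, `ε 2 0 = ε 1 2 = −1`** — i.e. `ArchHcJump` at `n = 0` with
`jc′ S′ w i j := ε i j · (I * C₁ / C₂)`, free of `S′`, `w`, `p`, `a′`.  (Non-admissible `S′`: both sides vanish; the guard excludes the compact pair `{0, 1}`.)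
[cite: Shelstad1979, Prop. 4.5 (p. 26); Thm. 4.7 (IIIb) (p. 31)] [cite: Bouaziz1994IntegralesOrbitales, §3.2 (I₃) p. 580; Rem. 2 p. 594] [cite: Rogawski1990, §8.2 Prop. 8.2.1 (c) p. 119; pp. 122–124]
[cite: Varadarajan1977, I §1.12] -/
theorem hasOneSidedJump_archERhoG_mul_orbFamGExt_orderZero :
  ∀ (L : Type) [Field L] [NumberField L] [IsCMField L] (α : Fin 3 → L)
    [MeasurableSpace (↥(arch (↥(maximalRealSubfield L)) L (IsCMField.complexConj L) 3 (Matrix.diagonal α)))] [BorelSpace (↥(arch (↥(maximalRealSubfield L)) L (IsCMField.complexConj L) 3 (Matrix.diagonal α)))]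
    (ν' : Measure (↥(arch (↥(maximalRealSubfield L)) L (IsCMField.complexConj L) 3 (Matrix.diagonal α)))) [ν'.IsHaarMeasure] [ν'.IsMulRightInvariant],
    ((Matrix.diagonal α).map (cmConjRingHom L)).transpose = Matrix.diagonal α →
    (∀ x : Fin 3 → L, Literature.AlgebraicGeometry.ShimuraVarieties.hermForm (cmConjRingHom L) (Matrix.diagonal α) x x = 0 → x = 0) →
    ∀ {J : Matrix (Fin 2) (Fin 2) ℂ} (hJ : J = (StdForm.antidiagonal 2).over ℂ)
      [MeasurableSpace ↥(unitaryGroupOfForm (starRingEnd ℂ) J)] [BorelSpace ↥(unitaryGroupOfForm (starRingEnd ℂ) J)]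
      [LocallyCompactSpace ↥(unitaryGroupOfForm (starRingEnd ℂ) J)] [SecondCountableTopology ↥(unitaryGroupOfForm (starRingEnd ℂ) J)]
      [MeasurableSpace (↥(unitaryGroupOfForm (starRingEnd ℂ) J) ⧸ torusU (starRingEnd ℂ) J)] [BorelSpace (↥(unitaryGroupOfForm (starRingEnd ℂ) J) ⧸ torusU (starRingEnd ℂ) J)]
      (μ₀ : Measure ↥(unitaryGroupOfForm (starRingEnd ℂ) J)) [μ₀.IsHaarMeasure] [μ₀.IsMulRightInvariant]
      (μ₀' : Measure (↥(unitaryGroupOfForm (starRingEnd ℂ) J) ⧸ torusU (starRingEnd ℂ) J)) [SMulInvariantMeasure ↥(unitaryGroupOfForm (starRingEnd ℂ) J) (↥(unitaryGroupOfForm (starRingEnd ℂ) J) ⧸ torusU (starRingEnd ℂ) J) μ₀'] [IsFiniteMeasureOnCompacts μ₀']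
      (C₁ C₂ : ℝ), 0 < C₁ → 0 < C₂ →
      (∀ (f : Matrix (Fin 2) (Fin 2) ℂ → ℂ), Continuous f → HasCompactSupport f → ∀ z : Circle,
        HasOneSidedJump (fun ψ : ℝ => (2 * Real.sin ψ : ℂ) *
            ∫ h : ↥(unitaryGroupOfForm (starRingEnd ℂ) J),
              f (((h * ⟨Matrix.GeneralLinearGroup.mkOfDetNeZero !![(1 : ℂ), 1; 1, -1] det_cayleyTwo_ne_zero *
                    circleDiagonal 2 ![z * Circle.exp ψ, z * Circle.exp (-ψ)] *
                    (Matrix.GeneralLinearGroup.mkOfDetNeZero !![(1 : ℂ), 1; 1, -1] det_cayleyTwo_ne_zero)⁻¹,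
                  cayley_conj_circleDiagonal_mem_of_eq_over hJ _⟩ * h⁻¹ :
                ↥(unitaryGroupOfForm (starRingEnd ℂ) J)) : GL (Fin 2) ℂ) : Matrix (Fin 2) (Fin 2) ℂ) ∂μ₀)
          ((C₁ : ℂ) * ((∫ p in Ioi (0 : ℝ) ×ˢ Ioc (0 : ℝ) (2 * π),
              f ((!![(1 : ℂ), 1; 1, -1] : Matrix (Fin 2) (Fin 2) ℂ) *
                ((z : ℂ) • (1 : Matrix (Fin 2) (Fin 2) ℂ) + p.1 • Matrix.diagonal ![(z : ℂ) * I, -((z : ℂ) * I)] +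
                  p.1 • !![(0 : ℂ), -((z : ℂ) * I) * cexp (-((p.2 : ℂ) * I)); ((z : ℂ) * I) * cexp ((p.2 : ℂ) * I), 0]) *
                !![(1 / 2 : ℂ), 1 / 2; 1 / 2, -(1 / 2)])) +
            ∫ p in Ioi (0 : ℝ) ×ˢ Ioc (0 : ℝ) (2 * π),
              f ((!![(1 : ℂ), 1; 1, -1] : Matrix (Fin 2) (Fin 2) ℂ) *
                ((z : ℂ) • (1 : Matrix (Fin 2) (Fin 2) ℂ) + p.1 • Matrix.diagonal ![-((z : ℂ) * I), (z : ℂ) * I] +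
                  p.1 • !![(0 : ℂ), ((z : ℂ) * I) * cexp (-((p.2 : ℂ) * I)); -((z : ℂ) * I) * cexp ((p.2 : ℂ) * I), 0]) *
                !![(1 / 2 : ℂ), 1 / 2; 1 / 2, -(1 / 2)])))) →
      (∀ (f : Matrix (Fin 2) (Fin 2) ℂ → ℂ), Continuous f → HasCompactSupport f → ∀ θ : ℝ,
      Tendsto (fun x : ℝ => |Real.exp x - Real.exp (-x)| •
          ∫ y, descConj (⟨hypBlockGL x θ, hypBlockGL_mem_of_eq_over hJ x θ⟩ : ↥(unitaryGroupOfForm (starRingEnd ℂ) J)) (torusU (starRingEnd ℂ) J)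
            (LineRing.forall_mem_torusU_comm (starRingEnd ℂ) J (hypBlockGL_mem_torusU hJ x θ))
            (fun g : ↥(unitaryGroupOfForm (starRingEnd ℂ) J) => f ((g : GL (Fin 2) ℂ) : Matrix (Fin 2) (Fin 2) ℂ)) y ∂μ₀')
        (𝓝[≠] 0)
        (𝓝 (C₂ • ((∫ p in Ioi (0 : ℝ) ×ˢ Ioc (0 : ℝ) (2 * π),
            f ((!![(1 : ℂ), 1; 1, -1] : Matrix (Fin 2) (Fin 2) ℂ) *
              (Complex.exp ((θ : ℂ) * Complex.I) • (1 : Matrix (Fin 2) (Fin 2) ℂ) +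
                p.1 • Matrix.diagonal ![Complex.exp ((θ : ℂ) * Complex.I) * Complex.I, -(Complex.exp ((θ : ℂ) * Complex.I) * Complex.I)] +
                p.1 • !![(0 : ℂ), -(Complex.exp ((θ : ℂ) * Complex.I) * Complex.I) * Complex.exp (-((p.2 : ℂ) * Complex.I));
                  (Complex.exp ((θ : ℂ) * Complex.I) * Complex.I) * Complex.exp ((p.2 : ℂ) * Complex.I), 0]) *
              !![(1 / 2 : ℂ), 1 / 2; 1 / 2, -(1 / 2)])) +
          ∫ p in Ioi (0 : ℝ) ×ˢ Ioc (0 : ℝ) (2 * π),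
            f ((!![(1 : ℂ), 1; 1, -1] : Matrix (Fin 2) (Fin 2) ℂ) *
              (Complex.exp ((θ : ℂ) * Complex.I) • (1 : Matrix (Fin 2) (Fin 2) ℂ) +
                p.1 • Matrix.diagonal ![-(Complex.exp ((θ : ℂ) * Complex.I) * Complex.I), Complex.exp ((θ : ℂ) * Complex.I) * Complex.I] +
                p.1 • !![(0 : ℂ), (Complex.exp ((θ : ℂ) * Complex.I) * Complex.I) * Complex.exp (-((p.2 : ℂ) * Complex.I));
                  -(Complex.exp ((θ : ℂ) * Complex.I) * Complex.I) * Complex.exp ((p.2 : ℂ) * Complex.I), 0]) *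
              !![(1 / 2 : ℂ), 1 / 2; 1 / 2, -(1 / 2)]))))) →
      (∀ (ρ : Measure ↥(torusU (starRingEnd ℂ) J)) [ρ.IsHaarMeasure] [ρ.IsInvInvariant],
    μ₀' = ρ ((fun p : ℝ × ℝ =>
        (⟨⟨hypBlockGL p.1 p.2, hypBlockGL_mem_of_eq_over hJ p.1 p.2⟩, hypBlockGL_mem_torusU hJ p.1 p.2⟩ : ↥(torusU (starRingEnd ℂ) J))) ''
          (Set.Icc (0 : ℝ) 1 ×ˢ Set.Icc (0 : ℝ) (2 * π))) •
      quotientMeasure (torusU (starRingEnd ℂ) J) ρ (LineRing.isClosed_torusU_two (starRingEnd ℂ) J) μ₀) →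
    ∀ a' : ↥(arch (↥(maximalRealSubfield L)) L (IsCMField.complexConj L) 3 (Matrix.diagonal α)) → ℂ, ArchSmooth L 3 (Matrix.diagonal α) a' →
      (∀ S' : Finset ({w : InfinitePlace L // IsComplex w}), ContDiffOn ℝ ∞ (orbFamGExt L α ν' a' S') (InRegG (slotSign L α) S')) →
      ∀ (S' : Finset ({w : InfinitePlace L // IsComplex w})) (w : {w : InfinitePlace L // IsComplex w}), w ∉ S' →
        ∀ (i j : Fin 3), i ≠ j → slotSign L α w i ≠ slotSign L α w j →
        ∀ p : {w : InfinitePlace L // IsComplex w} → Fin 3 → ℝ, HcSemireg S' w i j p →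
          HasOneSidedJump (fun ν : ℝ => archERhoG S' (p + ν • hcNrm w i j) * orbFamGExt L α ν' a' S' (p + ν • hcNrm w i j))
            (((if i = 0 ∧ j = 2 ∨ i = 2 ∧ j = 1 then 1 else if i = 2 ∧ j = 0 ∨ i = 1 ∧ j = 2 then -1 else 0 : ℂ) * (I * C₁ / C₂)) *
              (archERhoG (insert w S') (hcCayPt w i j p) * orbFamGExt L α ν' a' (insert w S') (hcCayPt w i j p))) := by
  intro L _ _ _ α _ _ ν' _ _ hherm hanis J hJ _ _ _ _ _ _ μ₀ _ _ μ₀' _ _ C₁ C₂ hC₁ hC₂ hK0 hA0 hlink a' ha' hI₂ S' w hw i j hij hsij p hp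
  have hα : ∀ i, α i ≠ 0 := ne_zero_of_diagonal_anisotropic hanis
  have hreal : ∀ (w : {w : InfinitePlace L // IsComplex w}) (i : Fin 3), (w.1.embedding (α i)).im = 0 :=
    fun w i => im_embedding_diagonal_eq_zero L 3 α (complexConj_apply_eq_of_diagonal_frame hherm) w i
  by_cases hadm : ∀ w' ∈ S', w' ∈ splitChartPlaces L α
  swap
  · -- a non-admissible chart: both members vanish identically (★ `orbFamGExt_of_not_admissible`)
    have hadm' : ¬ ∀ w', w' ∈ insert w S' → w' ∈ splitChartPlaces L α :=
      fun h => hadm fun w' hw' => h w' (Finset.mem_insert_of_mem hw')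
    rw [orbFamGExt_of_not_admissible L α ν' a' S' hadm, orbFamGExt_of_not_admissible L α ν' a' (insert w S') hadm']
    simp only [mul_zero]
    exact ⟨0, 0, tendsto_const_nhds, tendsto_const_nhds, sub_self 0⟩
  -- an admissible chart; `w` is indefinite for `diag α`, hence a split-chart place, and `slotSign w 0 = slotSign w 1 ≠ slotSign w 2`
  have hind : ¬ (formSign L α w 0 = formSign L α w 1 ∧ formSign L α w 1 = formSign L α w 2) := by
    rintro ⟨h01, h12⟩
    have hall : ∀ k : Fin 3, formSign L α w k = formSign L α w 0 := by
      intro k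
      fin_cases k
      · rfl
      · exact h01.symm
      · exact h12.symm.trans h01.symm
    apply hsij
    rw [slotSign_apply, slotSign_apply, hall (lineOf (formSign L α w) i), hall (lineOf (formSign L α w) j)]
  have hwsp : w ∈ splitChartPlaces L α := mem_splitChartPlaces_of_frame hα (hreal w) hind
  obtain ⟨h10, -, -⟩ := slotSign_of_mem_splitChartPlaces L α hα hwsp
  have hs01 : slotSign L α w 0 = slotSign L α w 1 := h10.symm
  have hW : ArchHcWeyl (slotSign L α) (orbFamGExt L α ν' a') := archHcWeyl_orbFamGExt L α ν' hα hreal a'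
  -- the core at the wall `(0, 2)` (§2), at every semiregular point of it
  have core : ∀ q : {w : InfinitePlace L // IsComplex w} → Fin 3 → ℝ, HcSemireg S' w 0 2 q →
      HasOneSidedJump (fun ν : ℝ => archERhoG S' (q + ν • hcNrm w 0 2) * orbFamGExt L α ν' a' S' (q + ν • hcNrm w 0 2))
        ((I * C₁ / C₂ : ℂ) * (archERhoG (insert w S') (hcCayPt w 0 2 q) * orbFamGExt L α ν' a' (insert w S') (hcCayPt w 0 2 q))) :=
    fun q hq => hasOneSidedJump_archERhoG_mul_orbFamGExt_wall02 L α ν' hherm hanis hJ μ₀ μ₀' C₁ C₂ hC₁ hC₂ hK0 hA0 hlink S' w q hadm hw hwsp hq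
      a' ha' (hI₂ _)
  -- the wall `(1, 2)` from the core at `σp` (§3, the realised reflection `(0 1)`)
  have wall12 : ∀ q : {w : InfinitePlace L // IsComplex w} → Fin 3 → ℝ, HcSemireg S' w 1 2 q →
      HasOneSidedJump (fun ν : ℝ => archERhoG S' (q + ν • hcNrm w 1 2) * orbFamGExt L α ν' a' S' (q + ν • hcNrm w 1 2))
        (-((I * C₁ / C₂ : ℂ) * (archERhoG (insert w S') (hcCayPt w 1 2 q) * orbFamGExt L α ν' a' (insert w S') (hcCayPt w 1 2 q)))) := by
    intro q hq
    rw [hcCayPt_one_two_eq_hcCayPt_zero_two_hcSwapAt]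
    exact hasOneSidedJump_wall_one_two_of_zero_two hW hw hs01 hq (core _ (hq.hcSwapAt_zero_one hw))
  -- case analysis on the ordered pair `(i, j)`: the four noncompact pairs
  rcases noncompactPair_cases hs01 hij hsij with ⟨rfl, rfl⟩ | ⟨rfl, rfl⟩ | ⟨rfl, rfl⟩ | ⟨rfl, rfl⟩
  · rw [if_pos (by decide), one_mul]
    exact core p hp
  · rw [if_neg (by decide), if_pos (by decide), neg_one_mul, neg_mul, hcCayPt_swap w 0 2 p]
    exact hasOneSidedJump_pair_swap (G := fun c => archERhoG S' c * orbFamGExt L α ν' a' S' c) (core p hp.pair_swap)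
  · rw [if_neg (by decide), if_pos (by decide), neg_one_mul, neg_mul]
    exact wall12 p hp
  · rw [if_pos (by decide), one_mul, hcCayPt_swap w 1 2 p]
    have h := hasOneSidedJump_pair_swap (G := fun c => archERhoG S' c * orbFamGExt L α ν' a' S' c) (wall12 p hp.pair_swap)
    rw [neg_neg] at h
    exact h

end Literature.NumberTheory.Rogawski1990

end
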